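import Summits.NavierStokesRegularity.FluidComputer.PalasekTowerEpisodes

/-!
# Kinematics of a stage: the floors and ceilings force a material acceleration in the ball

Cell `ns-blowup`, seat `ns-blowup-ecbridge-1` (g2); companion of `PalasekTowerEpisodes.lean`
(p404510). LABEL: E-C typing (a quantitative property EVERY stage has; kernel); WHAT THIS IS NOT:
not Navier–Stokes evidence — nothing is constructed.

At level `k+1` a stage's velocity at the floor point rises from `≤ c₂ Y_k` (the level-`k` ceiling,
valid up to `τ k`) to `≥ c₁ Y_{k+1}` at `τ (k+1)`; by the mean value inequality its time derivative in
the ball cannot stay below `(c₁ Y_{k+1} − c₂ Y_k) / (τ (k+1) − τ k)` on the inter-readout interval: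
`Stage.jump_le_mul_gap`; and since the admissible force is `≤ c₄ Y_k` there, the NON-FORCE part of
the acceleration (`= νΔu − ∇p − (u·∇)u` by the momentum equation) obeys
`jump ≤ (D + c₄ Y_k) · gap` (`Stage.jump_le_of_nonforce_le`). Two uses: (i) compactness (`TowerCompactness`, file `PalasekTowerDepth`):
a UNIFORM bound on the time derivative keeps consecutive readout times uniformly separated, so limit
schedules stay strictly increasing; (ii) junk exclusion read quantitatively: on the register
(STATUS l.1039: window equality, jump `≍ Y_{k+1}`, gap `= c₅ log N_{k+1} / A_k`) the acceleration
scale a stage must realise is `≍ Y_{k+1} A_k / (c₅ log N_{k+1})`, while the admissible force is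
`≤ c₄ Y_k` — so it is the transport / pressure terms, i.e. genuine dynamics, that carry it.

References: S. Palasek, arXiv:2605.13827 §3.3 [cite: Palasek2026ElementaryModel, §3.3].
-/

noncomputable section

namespace Summit.NavierStokesRegularity.FluidComputer.PalasekTowerClayBridge

open Set MeasureTheory Filter Topology Function
open scoped ENNReal ContDiff NNReal
open Literature.Analysis.FluidPDE

namespace Stage

variable {ν : ℝ} {R : TowerRates} {S : Schedule R} {m : Margins R} {k : ℕ}

/-- Each time line `t ↦ u t x` of a stage has the one-sided time derivative `timeDerivWithin` within
its slab (joint smoothness of the classical solution). [folklore] -/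
theorem hasDerivWithinAt_time (s : Stage ν R S m k) {t : ℝ} (ht : t ∈ Icc 0 (S.τ k))
    (x : EuclideanSpace ℝ (Fin 3)) :
    HasDerivWithinAt (fun r => s.u r x) (timeDerivWithin (Icc 0 (S.τ k)) s.u t x)
      (Icc 0 (S.τ k)) t := by
  rw [timeDerivWithin_apply]
  exact (s.classical.smooth_velocity.differentiableWithinAt_time ht x).hasDerivWithinAt

/-- **The jump is at most the acceleration bound times the gap.** If the time derivative of a
level-`(k+1)` stage is bounded by `C` on `[τ k, τ (k+1)]` at every point of the ball, then
`c₁ Y_{k+1} − c₂ Y_k ≤ C · (τ (k+1) − τ k)`: at the floor point of level `k+1` the speed is `≤ c₂ Y_k`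
at `τ k` (level-`k` ceiling) and `≥ c₁ Y_{k+1}` at `τ (k+1)` (floor), and the mean value inequality on
the segment bounds the difference. [folklore] -/
theorem jump_le_mul_gap (s : Stage ν R S m (k + 1)) {C : ℝ}
    (hC : ∀ t ∈ Icc (S.τ k) (S.τ (k + 1)), ∀ x, ‖x‖ ≤ S.radius →
      ‖timeDerivWithin (Icc 0 (S.τ (k + 1))) s.u t x‖ ≤ C) :
    S.c₁ * R.Y (k + 1) - S.c₂ * R.Y k ≤ C * (S.τ (k + 1) - S.τ k) := by
  obtain ⟨x, hx, hfloor⟩ := s.floor (k + 1) le_rfl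
  have hτk : 0 ≤ S.τ k := (S.τ_pos k).le
  have hτle : S.τ k ≤ S.τ (k + 1) := (S.τ_lt_succ k).le
  -- the time line at the floor point, with its derivative within the sub-segment
  have hderiv : ∀ t ∈ Icc (S.τ k) (S.τ (k + 1)),
      HasDerivWithinAt (fun r => s.u r x) (timeDerivWithin (Icc 0 (S.τ (k + 1))) s.u t x)
        (Icc (S.τ k) (S.τ (k + 1))) t := by
    intro t ht
    exact (s.hasDerivWithinAt_time ⟨le_trans hτk ht.1, ht.2⟩ x).mono
      (Icc_subset_Icc_left hτk)
  have hbound : ∀ t ∈ Ico (S.τ k) (S.τ (k + 1)),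
      ‖timeDerivWithin (Icc 0 (S.τ (k + 1))) s.u t x‖ ≤ C :=
    fun t ht => hC t (Ico_subset_Icc_self ht) x hx
  have hmvt := norm_image_sub_le_of_norm_deriv_le_segment' hderiv hbound (S.τ (k + 1))
    (right_mem_Icc.2 hτle)
  -- speed at `τ k` is under the level-`k` ceiling
  have hceil : ‖s.u (S.τ k) x‖ ≤ S.c₂ * R.Y k :=
    s.ceiling k (Nat.le_succ k) (S.τ k) ⟨hτk, le_rfl⟩ x
  -- triangle inequality
  have htri : ‖s.u (S.τ (k + 1)) x‖ ≤ ‖s.u (S.τ k) x‖ + ‖s.u (S.τ (k + 1)) x - s.u (S.τ k) x‖ := by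
    have := norm_add_le (s.u (S.τ k) x) (s.u (S.τ (k + 1)) x - s.u (S.τ k) x)
    rwa [add_sub_cancel] at this
  linarith

/-- **Corollary (no uniform bound below the ratio).** The time derivative of a level-`(k+1)` stage
cannot be bounded, on `[τ k, τ (k+1)]` in the ball, by any constant smaller than
`(c₁ Y_{k+1} − c₂ Y_k) / (τ (k+1) − τ k)`. [folklore] -/
theorem not_timeDeriv_lt (s : Stage ν R S m (k + 1)) {C : ℝ}
    (hlt : C * (S.τ (k + 1) - S.τ k) < S.c₁ * R.Y (k + 1) - S.c₂ * R.Y k) :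
    ¬ ∀ t ∈ Icc (S.τ k) (S.τ (k + 1)), ∀ x, ‖x‖ ≤ S.radius →
      ‖timeDerivWithin (Icc 0 (S.τ (k + 1))) s.u t x‖ ≤ C :=
  fun hC => absurd (s.jump_le_mul_gap hC) (not_le.2 hlt)

/-- **Uniform acceleration bounds separate the readouts.** If the time derivative of a
level-`(k+1)` stage is bounded by `C > 0` in the ball on `[τ k, τ (k+1)]`, the readouts are at least
`(c₁ Y_{k+1} − c₂ Y_k) / C` apart — the ingredient that keeps limit schedules strictly increasing
in the compactness step of SHAPE-E. [folklore] -/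
theorem gap_ge_of_timeDeriv_le (s : Stage ν R S m (k + 1)) {C : ℝ} (hCpos : 0 < C)
    (hC : ∀ t ∈ Icc (S.τ k) (S.τ (k + 1)), ∀ x, ‖x‖ ≤ S.radius →
      ‖timeDerivWithin (Icc 0 (S.τ (k + 1))) s.u t x‖ ≤ C) :
    (S.c₁ * R.Y (k + 1) - S.c₂ * R.Y k) / C ≤ S.τ (k + 1) - S.τ k := by
  rw [div_le_iff₀ hCpos]
  have h := s.jump_le_mul_gap hC
  linarith

/-- **The self-interaction carries the jump.** By the momentum equation `∂ₜu − f = νΔu − ∇p − (u·∇)u`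
on the slab; if this NON-FORCE part of the acceleration is bounded by `D` in the ball on
`[τ k, τ (k+1)]`, then, since the admissible force there is `≤ c₄ Y_k` (`Schedule.push_small`),
`c₁ Y_{k+1} − c₂ Y_k ≤ (D + c₄ Y_k) · (τ (k+1) − τ k)`. On the planner's register (window equality:
gap `= c₅ log N_{k+1} / A_k`, `c₄ Y_k · gap ≪ jump`) this pins the self-interaction scale of any
stage at `≳ Y_{k+1} A_k / (c₅ log N_{k+1})` — genuine dynamics, not the force, makes the level. [folklore] -/
theorem jump_le_of_nonforce_le (s : Stage ν R S m (k + 1)) {D : ℝ}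
    (hD : ∀ t ∈ Icc (S.τ k) (S.τ (k + 1)), ∀ x, ‖x‖ ≤ S.radius →
      ‖timeDerivWithin (Icc 0 (S.τ (k + 1))) s.u t x - S.f t x‖ ≤ D) :
    S.c₁ * R.Y (k + 1) - S.c₂ * R.Y k ≤ (D + S.c₄ * R.Y k) * (S.τ (k + 1) - S.τ k) := by
  refine s.jump_le_mul_gap fun t ht x hx => ?_
  have h1 := hD t ht x hx
  have h2 := S.push_small k t ht x
  calc ‖timeDerivWithin (Icc 0 (S.τ (k + 1))) s.u t x‖
      = ‖(timeDerivWithin (Icc 0 (S.τ (k + 1))) s.u t x - S.f t x) + S.f t x‖ := by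
        rw [sub_add_cancel]
    _ ≤ ‖timeDerivWithin (Icc 0 (S.τ (k + 1))) s.u t x - S.f t x‖ + ‖S.f t x‖ := norm_add_le _ _
    _ ≤ D + S.c₄ * R.Y k := add_le_add h1 h2

end Stage

end Summit.NavierStokesRegularity.FluidComputer.PalasekTowerClayBridge

end
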